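import Summits.CriticalPhenomena.PercolationContinuityZ3.Theses.PercNearOneGluing
import Literature.Probability.Percolation.PercolationProofs
import Literature.Probability.Percolation.ConditionalPositiveAssociationProofs
import Literature.Probability.Percolation.TwoClusterConditionalAssociationProofs

/-! TTRL-lite variant V2070 of stmt-CriticalPhenomena-4576 -/

namespace Summit.CriticalPhenomena.PercolationContinuityZ3.Theorems

open MeasureTheory Literature.Probability.LatticeModels Literature.Probability.Percolation
open scoped Classical BigOperators

/-- TTRL-lite variant V2070 of the good-step statement of `stmt-CriticalPhenomena-4576`,
specialised to `n = 5` with `A.card = 4`.  Since `o ∉ A` forces `Aᶜ = {o}` in `Fin 5`, the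
hypothesis `∃ y ∉ A, y ≠ o ∧ …` is contradictory, so the statement holds vacuously. -/
theorem cp4576_goodstep_var2070 :
    ∀ (w : Sym2 (Fin 5) → unitInterval) (A : Finset (Fin 5)) (o b : Fin 5), A.card = 4 → b ∈ A →
      o ∉ A → (∃ y : Fin 5, y ∉ A ∧ y ≠ o ∧ (w s(o, y) : ℝ) ≠ 0) →
      (∀ w' : Sym2 (Fin 5) → unitInterval,
        (Finset.univ.filter (fun v : Fin 5 => ∃ u : Fin 5, 0 < (w' s(u, v) : ℝ))).card <
          (Finset.univ.filter (fun v : Fin 5 => ∃ u : Fin 5, 0 < (w s(u, v) : ℝ))).card →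
        ∀ (A' : Finset (Fin 5)) (o' b' : Fin 5), b' ∈ A' → o' ∉ A' →
          ∀ (t : ℝ) (sel : Finset (Fin 5) → Fin 5), (∀ W, sel W ∈ A') →
            (∀ a ∈ A', 1 - t ≤ (prodBernoulli w').real (openConn a b')) →
            (prodBernoulli w').real ((⋃ a ∈ A', openConn o' a) ∩ (openConn o' b')ᶜ) +
              ∑ W ∈ (Finset.univ : Finset (Finset (Fin 5))).filter
                  (fun W => o' ∈ W ∧ Disjoint W A'),
                (prodBernoulli w').real
                    {ω : BondConfig (Fin 5) | openCluster ω o' = (W : Set (Fin 5))} *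
                  (prodBernoulli w').real (openConnIn ((W : Set (Fin 5))ᶜ) (sel W) b')ᶜ ≤ t) →
      ∀ (t : ℝ) (sel : Finset (Fin 5) → Fin 5), (∀ W, sel W ∈ A) →
        (∀ a ∈ A, 1 - t ≤ (prodBernoulli w).real (openConn a b)) →
        (prodBernoulli w).real ((⋃ a ∈ A, openConn o a) ∩ (openConn o b)ᶜ) +
          ∑ W ∈ (Finset.univ : Finset (Finset (Fin 5))).filter (fun W => o ∈ W ∧ Disjoint W A),
            (prodBernoulli w).real {ω : BondConfig (Fin 5) | openCluster ω o = (W : Set (Fin 5))} *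
              (prodBernoulli w).real (openConnIn ((W : Set (Fin 5))ᶜ) (sel W) b)ᶜ ≤ t := by
  intro w A o _ hA _ ho hy
  exfalso
  obtain ⟨y, hyA, hyo, _⟩ := hy
  have h1 : (Aᶜ).card = 1 := by
    rw [Finset.card_compl, hA]; simp
  have h2 : 1 < (Aᶜ).card :=
    Finset.one_lt_card.mpr ⟨y, Finset.mem_compl.mpr hyA, o, Finset.mem_compl.mpr ho, hyo⟩
  omega

end Summit.CriticalPhenomena.PercolationContinuityZ3.Theorems
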